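import Literature.RingTheory.FormalGroups.FormalOModuleLaw
import Literature.RingTheory.TwoVariableSeries.Basic
import Mathlib.Algebra.CharP.Lemmas
import HarnessLib

/-!
# Height of a one-dimensional commutative formal group law (`[p]_F(T) = u(T^{p^h})`); `[n]`-series of `𝔾ₐ`, `𝔾ₘ`
# ([Hazewinkel 1978] §18.3; [Silverman 2009] IV §3, IV.7; [Lubin–Tate 1965] §1)

Topic `Literature/RingTheory/FormalGroups`; namespace `Literature.RingTheory.FormalGroups`.  DEFINITIONS + fully proved
theorems; no named fact, no instance, no notation, no `sorry`.  Cell `hodgecm-mathlib`, P6 «MOD programme» ROW 4B (sub-desk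
F0P6d: ED. 2 card «v5's law-side height predicate will defer to ★ where the shapes agree»; letters 3b-ht `HeightLiftsAlongSurjection`,
`IsConnectedDimOne` special fibres `k[X]⧸(X^{p^{nh}})`).  Over Mathlib `FormalGroup` + ★ `FormalGroupHomAdd` (`nsmulHom = [n]_F`) +
★ `FormalOModuleLaw` (`IsOfHeight`, the `𝒪`-module height).

## Contents

* `[n]`-series of the two Mathlib examples: `nsmulHom_Ga_toPowerSeries : [n]_{𝔾ₐ}(T) = n·T`,
  `nsmulHom_Gm_toPowerSeries : [n]_{𝔾ₘ}(T) = (1+T)^n − 1`; in characteristic `p`: `[p]_{𝔾ₐ} = 0`, `[p]_{𝔾ₘ}(T) = T^p`.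
* `FormalGroup`-level HEIGHT as a `Prop`: `IsOfPHeight F p h` ⟺ `[p]_F(T) = u(T^{p^h})` with `u ∈ T·A⟦T⟧`, `u₁ ∈ Aˣ`
  ([Hazewinkel1978] §18.3 Def. (18.3.3); [SilvermanAEC2009] IV Def. 7.? «height»); `natCast_eq_zero_of_isOfPHeight` (`h ≥ 1 ⇒ p = 0` in
  `A`); `isOfPHeight_Gm_one` (`𝔾ₘ` has height `1` in characteristic `p`); `not_isOfPHeight_Ga` (`𝔾ₐ` has no finite height in
  characteristic `p` over a nontrivial ring).
* the DICTIONARY with the `𝒪`-module height of ★ `FormalOModuleLaw`: `isOfHeight_natCast_iff : M.IsOfHeight (p : 𝒪) p h ↔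
  IsOfPHeight M.toFormalGroup p h` (via ★ `act_natCast : ρ p = [p]_F`).

Deliberately NOT here: «every law over a field of characteristic `p` has `[p] = g(T^{p^h})`» (needs the invariant differential),
well-definedness of `h`, base change of heights, Lazard's classification.
-/

noncomputable section

namespace Literature.RingTheory.FormalGroups

open _root_.MvPowerSeries (HasSubst subst)

universe u v

variable {A : Type u} [CommRing A]

namespace FormalGroupHom

/-! ## §1 `[n]`-series of `𝔾ₐ` and `𝔾ₘ` -/

/-- `[n]_{𝔾ₐ}(T) = n·T`. [cite: Hazewinkel1978, §1.2 (1.2.4)] -/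
theorem nsmulHom_Ga_toPowerSeries (n : ℕ) :
    (nsmulHom (FormalGroup.𝔾ₐ (R := A)) n).toPowerSeries = (n : A) • PowerSeries.X := by
  induction n with
  | zero => simp
  | succ n ih =>
    have hc : HasSubst ![(n : A) • (PowerSeries.X : PowerSeries A), PowerSeries.X] :=
      hasSubst_pair (PowerSeries.HasSubst.smul_X' _) PowerSeries.HasSubst.X'
    rw [nsmulHom_succ, add_toPowerSeries, ih, id_toPowerSeries, FormalGroup.𝔾ₐ_toPowerSeries,
      MvPowerSeries.subst_add hc, MvPowerSeries.subst_X hc, MvPowerSeries.subst_X hc]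
    simp [add_smul]

/-- `[n]_{𝔾ₘ}(T) = (1 + T)^n − 1`. [cite: Hazewinkel1978, §1.2 (1.2.4)] -/
theorem nsmulHom_Gm_toPowerSeries (n : ℕ) :
    (nsmulHom (FormalGroup.𝔾ₘ (R := A)) n).toPowerSeries = (1 + PowerSeries.X) ^ n - 1 := by
  induction n with
  | zero => simp
  | succ n ih =>
    have h0 : PowerSeries.constantCoeff ((1 + PowerSeries.X) ^ n - 1 : PowerSeries A) = 0 := by simp
    have hc : HasSubst ![((1 + PowerSeries.X) ^ n - 1 : PowerSeries A), PowerSeries.X] :=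
      hasSubst_pair (PowerSeries.HasSubst.of_constantCoeff_zero' h0) PowerSeries.HasSubst.X'
    rw [nsmulHom_succ, add_toPowerSeries, ih, id_toPowerSeries, FormalGroup.𝔾ₘ_toPowerSeries,
      MvPowerSeries.subst_add hc, MvPowerSeries.subst_add hc, MvPowerSeries.subst_mul hc, MvPowerSeries.subst_X hc,
      MvPowerSeries.subst_X hc]
    simp only [Matrix.cons_val_zero, Matrix.cons_val_one]
    ring

/-- In characteristic `p`: `[p]_{𝔾ₐ} = 0`. [cite: Hazewinkel1978, §18.3] -/
theorem nsmulHom_Ga_char (p : ℕ) [CharP A p] : (nsmulHom (FormalGroup.𝔾ₐ (R := A)) p).toPowerSeries = 0 := by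
  rw [nsmulHom_Ga_toPowerSeries, CharP.cast_eq_zero, zero_smul]

/-- In characteristic `p` (prime): `[p]_{𝔾ₘ}(T) = T^p`. [cite: Hazewinkel1978, §18.3] -/
theorem nsmulHom_Gm_char (p : ℕ) [Fact p.Prime] [CharP A p] :
    (nsmulHom (FormalGroup.𝔾ₘ (R := A)) p).toPowerSeries = PowerSeries.X ^ p := by
  haveI : CharP (PowerSeries A) p := Literature.RingTheory.TwoVariableSeries.charP_powerSeries p
  rw [nsmulHom_Gm_toPowerSeries, add_pow_char, one_pow, add_sub_cancel_left]

end FormalGroupHom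

/-! ## §2 Height with respect to `p` -/

/-- **Height `h` with respect to `p`** of a commutative one-dimensional formal group law `F` over `A` (as a `Prop`):
`[p]_F(T) = u(T^{p^h})` for some `u ∈ T·A⟦T⟧` with unit linear coefficient — so `[p]_F(T) = c·T^{p^h} + ` higher powers of `T^{p^h}`,
`c ∈ Aˣ`.  Intended over `𝔽_p`-algebras; no well-definedness in `h` is claimed here. [cite: Hazewinkel1978, §18.3 Def. (18.3.3)] -/
def IsOfPHeight (F : FormalGroup A) [F.IsComm] (p h : ℕ) : Prop :=
  ∃ u : PowerSeries A, PowerSeries.constantCoeff u = 0 ∧ IsUnit (PowerSeries.coeff 1 u) ∧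
    (FormalGroupHom.nsmulHom F p).toPowerSeries = PowerSeries.subst ((PowerSeries.X : PowerSeries A) ^ (p ^ h)) u

/-- A law of `p`-height `h` with `p^h ≥ 2` lives over a ring with `p = 0`: compare linear coefficients, `[p]₁ = p` (★ `coeff_one_nsmulHom`).
[cite: Hazewinkel1978, §18.3] -/
theorem natCast_eq_zero_of_isOfPHeight {F : FormalGroup A} [F.IsComm] {p h : ℕ} (hF : IsOfPHeight F p h) (hph : 2 ≤ p ^ h) :
    (p : A) = 0 := by
  obtain ⟨u, -, -, hu⟩ := hF
  rw [← FormalGroupHom.coeff_one_nsmulHom (F := F) p, hu, PowerSeries.coeff_subst_X_pow (by omega), if_neg (by rw [Nat.dvd_one]; omega)]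

/-- Below degree `p^h` all coefficients of `[p]_F` vanish for a law of `p`-height `h` (the residual-height reading, cf. the P6d line's
`HasResidualHeight`: over a field these coefficients lie in `𝔪 = 0`). [cite: Hazewinkel1978, §18.3 Def. (18.3.3)] -/
theorem coeff_nsmulHom_eq_zero_of_isOfPHeight {F : FormalGroup A} [F.IsComm] {p h : ℕ} (hF : IsOfPHeight F p h)
    (hp : p ^ h ≠ 0) {i : ℕ} (hi : i < p ^ h) : PowerSeries.coeff i (FormalGroupHom.nsmulHom F p).toPowerSeries = 0 := by
  obtain ⟨u, hu0, -, hu⟩ := hF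
  rw [hu, PowerSeries.coeff_subst_X_pow hp]
  split_ifs with hdvd
  · rcases Nat.eq_zero_or_pos i with rfl | hipos
    · rw [Nat.zero_div, PowerSeries.coeff_zero_eq_constantCoeff_apply, hu0, map_zero]
    · exact absurd (Nat.le_of_dvd hipos hdvd) (not_le.mpr hi)
  · rfl

/-- In degree `p^h` the coefficient of `[p]_F` is a UNIT for a law of `p`-height `h` (it is `u₁`). [cite: Hazewinkel1978, §18.3 Def. (18.3.3)] -/
theorem isUnit_coeff_nsmulHom_of_isOfPHeight {F : FormalGroup A} [F.IsComm] {p h : ℕ} (hF : IsOfPHeight F p h) (hp : p ^ h ≠ 0) :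
    IsUnit (PowerSeries.coeff (p ^ h) (FormalGroupHom.nsmulHom F p).toPowerSeries) := by
  obtain ⟨u, -, hu1, hu⟩ := hF
  rw [hu, PowerSeries.coeff_subst_X_pow hp, if_pos (dvd_refl _), Nat.div_self (Nat.pos_of_ne_zero hp)]
  simpa using hu1

/-- **`𝔾ₘ` has height `1` in characteristic `p`**: `[p]_{𝔾ₘ}(T) = T^p = u(T^{p^1})` with `u = T`. [cite: Hazewinkel1978, §18.3] -/
theorem isOfPHeight_Gm_one (p : ℕ) [Fact p.Prime] [CharP A p] : IsOfPHeight (FormalGroup.𝔾ₘ (R := A)) p 1 := by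
  refine ⟨PowerSeries.X, PowerSeries.constantCoeff_X, by simp, ?_⟩
  rw [FormalGroupHom.nsmulHom_Gm_char, pow_one, PowerSeries.subst_X (PowerSeries.HasSubst.X_pow (Fact.out : p.Prime).ne_zero)]

/-- **`𝔾ₐ` has no finite height in characteristic `p`** over a nontrivial ring: `[p]_{𝔾ₐ} = 0`, whereas `u(T^{p^h})` has the unit `u₁`
as its coefficient of `T^{p^h}`. [cite: Hazewinkel1978, §18.3] -/
theorem not_isOfPHeight_Ga [Nontrivial A] (p : ℕ) [Fact p.Prime] [CharP A p] (h : ℕ) :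
    ¬ IsOfPHeight (FormalGroup.𝔾ₐ (R := A)) p h := by
  rintro ⟨u, -, hu1, hu⟩
  rw [FormalGroupHom.nsmulHom_Ga_char] at hu
  have hk : p ^ h ≠ 0 := pow_ne_zero _ (Fact.out : p.Prime).ne_zero
  have h := congrArg (PowerSeries.coeff (p ^ h)) hu
  rw [map_zero, PowerSeries.coeff_subst_X_pow hk, if_pos (dvd_refl _), Nat.div_self (Nat.pos_of_ne_zero hk)] at h
  exact hu1.ne_zero (by simpa using h.symm)

/-! ## §3 Dictionary with the `𝒪`-module height -/

/-- For a formal `𝒪`-module law, the `𝒪`-module height at the element `p = p·1 ∈ 𝒪` (★ `FormalOModuleLaw.IsOfHeight`) IS the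
`p`-height of the underlying law, since `ρ(p) = [p]_F` (★ `act_natCast`).  (For `𝒪 = ℤ_p`, `π = p`, `q = p` the two notions agree.)
[cite: Hazewinkel1978, §21.1 (21.1.3)] -/
theorem FormalOModuleLaw.isOfHeight_natCast_iff {𝒪 : Type v} [CommRing 𝒪] [Algebra 𝒪 A] (M : FormalOModuleLaw 𝒪 A)
    (p h : ℕ) : M.IsOfHeight (p : 𝒪) p h ↔ (haveI := M.isComm; IsOfPHeight M.toFormalGroup p h) := by
  haveI := M.isComm
  simp only [FormalOModuleLaw.IsOfHeight, IsOfPHeight, M.act_natCast]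

end Literature.RingTheory.FormalGroups
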